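import Summits.QuantumFields.YangMills.Theorems.SwapVirialDeficitBlowUpGnomonicRelationQuaternions
import Summits.QuantumFields.YangMills.Theorems.SwapVirialDeficitEndCoreProductFloor
import HarnessLib

/-!
# THE LEADER GROUP DISTANCE TO THE BASE POINT IS CONTROLLED BY THE COMPRESSED LETTERS: `max_μ ‖su2Quat C′_μ − su2Quat C_μ‖ ≤ d(x) + d(y) + d(z)`,
# `d(v)² ≤ 2(v₁²+v₂²)/(1+|v|²)` (axial projection), `d(z)² ≤ 2|z|²/(1+|z|²)`
# (N2a step (iv) of `stub_end_gaussCore` — the input `hD` of w2's GROUP-distance law ✓`abs_log_det_gnoFolHessian_sub_le_leaders` (K7g) between a leader point and its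
# base point `gnoBase(x₀,y₀)` at the same hub; memo11a ∕ w3 memo-N2a(iv); free-hands support of ⟨stmt-QuantumFields-24197⟩ `SwapVirialDeficit.SwapGluedStiffness`)

At the gnomonic ends (`x₀ ≫ |u|`) the LETTER distance `|u|` to the base point is large while the GROUP distance `‖X̂ − X̂₀‖ ≍ |u|/√(1+x₀²+|u|²)` is small; the follower
determinant sees only the latter.  This file proves the quaternion identities:
* `norm_radialUnit_gnoLetter_sub_axial_sq_le (ε v) : ‖ν(±(1,v)) − ν(±(1,(v₀,0,0)))‖² ≤ 2(v₁²+v₂²)/(1+|v|²)`, `norm_radialUnit_gnoLetter_sub_sign_sq_le (ε z) :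
  ‖ν(±(1,z)) − ν(±(1,0))‖² ≤ 2|z|²/(1+|z|²)`;
* ★★ `leaderGroupDist_le (δ ε x y z F)` — for EVERY `μ : Fin 4`, at the hub `hubAt δ 1`:
  `‖su2Quat C_μ(gnoBase-point ((x₀,0,0),(y₀,0,0),0,F′)) − su2Quat C_μ(((x,y),(z,F)))‖ ≤ √(2(x₁²+x₂²)/(1+|x|²)) + √(2|z|²/(1+|z|²)) + √(2(y₁²+y₂²)/(1+|y|²))`
  (followers do not enter the leader tuple; ✓`leaders_hubAt_letters`; `C₁ = ν(a)⁻¹X̂ν(a)Ẑ` moves by `d(x) + d(z)` since unit quaternions multiply isometrically).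

HONEST LABEL: quaternion bookkeeping; N2a (iv)/(v), the glue and the plug of `stub_end_gaussCore`, and `stub_core_tip` are OPEN ⟹ ⟨24197⟩ ∕ ⟨24194⟩ OPEN; own crux ⟨22884⟩ OPEN
(blocked-on ⟨19935⟩); the Yang–Mills mass gap is NOT proved; no summit is proved by a line.  THEOREMS ONLY (0 `def`, 0 `sorry`), standard axioms.
Width seat ym-line-sfw-p2-w3 g67 (cell ym-idea-1, free hands), `--supports stmt-QuantumFields-24197`.  References: [folklore].
-/

set_option autoImplicit false

noncomputable section

open MeasureTheory Quaternion
open scoped BigOperators Quaternion RealInnerProductSpace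
open Literature.MathematicalPhysics.QuantumFieldTheory hiding SU2
open Literature.MathematicalPhysics.QuantumLattice
open Literature.Analysis.Calculus (radialUnit radialUnit_def norm_radialUnit)
open Literature.MathematicalPhysics.QuantumFieldTheory.DybalskiStottmeisterTanimoto2024.DST24CriticalPoint (inner_eq_components)

namespace Summit.QuantumFields.YangMills.Theorems.SwapVirialDeficit.BlowUpRing

open Summit.QuantumFields.YangMills.Theorems.FemtoTransferGap
open Summit.QuantumFields.YangMills.Theorems.FemtoTransferGap.TT
open Summit.QuantumFields.YangMills.Theorems.VirialFluxGap.RingDeficit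
open Summit.QuantumFields.YangMills.Theorems.SwapVirialDeficit.SwapRing

variable {L : ℕ}

/-! ## §1 Two radial units of letters with the same sign -/

/-- For two letters with the same sign, `‖ν(p) − ν(q)‖² = 2 − 2⟪p,q⟫/(‖p‖‖q‖)` and, when `⟪p,q⟫ = ‖q‖²` and `‖q‖ ≤ ‖p‖`, this is `≤ 2(‖p‖² − ‖q‖²)/‖p‖²`. [folklore] -/
theorem norm_radialUnit_sub_sq_le_of_inner_eq {p q : ℍ} (hp : p ≠ 0) (hq : q ≠ 0) (hinner : ⟪p, q⟫ = ‖q‖ ^ 2) (hle : ‖q‖ ≤ ‖p‖) :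
    ‖radialUnit p - radialUnit q‖ ^ 2 ≤ 2 * (‖p‖ ^ 2 - ‖q‖ ^ 2) / ‖p‖ ^ 2 := by
  have hP : 0 < ‖p‖ := norm_pos_iff.2 hp
  have hQ : 0 < ‖q‖ := norm_pos_iff.2 hq
  have h1 : ‖radialUnit p‖ = 1 := norm_radialUnit hp
  have h2 : ‖radialUnit q‖ = 1 := norm_radialUnit hq
  have hin : ⟪radialUnit p, radialUnit q⟫ = ‖q‖ / ‖p‖ := by
    rw [radialUnit_def, radialUnit_def, real_inner_smul_left, real_inner_smul_right, hinner]
    field_simp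
  have e : ‖radialUnit p - radialUnit q‖ ^ 2 = 2 - 2 * (‖q‖ / ‖p‖) := by
    rw [@norm_sub_sq_real, h1, h2, hin]; ring
  rw [e, div_eq_mul_inv, le_div_iff₀ (by positivity)]
  have hPinv : ‖p‖ * ‖p‖⁻¹ = 1 := mul_inv_cancel₀ hP.ne'
  nlinarith [hPinv, mul_nonneg hQ.le (sub_nonneg.2 hle), sq_nonneg ‖p‖]

/-- ★ Axial projection: `‖ν(±(1,v)) − ν(±(1,(v₀,0,0)))‖² ≤ 2(v₁²+v₂²)/(1+|v|²)` — the group distance of a letter to its axial part is the COMPRESSED transverse size. [folklore] -/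
theorem norm_radialUnit_gnoLetter_sub_axial_sq_le (ε : Bool) (v : Fin 3 → ℝ) :
    ‖radialUnit (gnoLetter ε v) - radialUnit (gnoLetter ε (![v 0, 0, 0] : Fin 3 → ℝ))‖ ^ 2 ≤
      2 * ((v 1) ^ 2 + (v 2) ^ 2) / (1 + ((v 0) ^ 2 + (v 1) ^ 2 + (v 2) ^ 2)) := by
  have hp := gnoLetter_ne_zero ε v
  have hq := gnoLetter_ne_zero ε (![v 0, 0, 0] : Fin 3 → ℝ)
  have hs : gnoSign ε ^ 2 = 1 := gnoSign_sq ε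
  obtain ⟨p0, p1, p2, p3⟩ := bfar_gnoLetter_components ε v
  obtain ⟨q0, q1, q2, q3⟩ := bfar_gnoLetter_components ε (![v 0, 0, 0] : Fin 3 → ℝ)
  have nP := bfar_norm_gnoLetter_sq ε v
  have nQ := bfar_norm_gnoLetter_sq ε (![v 0, 0, 0] : Fin 3 → ℝ)
  simp only [Matrix.cons_val_zero, Matrix.cons_val_one, Matrix.cons_val] at q1 q2 q3 nQ
  have hinner : ⟪gnoLetter ε v, gnoLetter ε (![v 0, 0, 0] : Fin 3 → ℝ)⟫ = ‖gnoLetter ε (![v 0, 0, 0] : Fin 3 → ℝ)‖ ^ 2 := by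
    rw [inner_eq_components, p0, p1, p2, p3, q0, q1, q2, q3, nQ]
    nlinarith [hs]
  have hle : ‖gnoLetter ε (![v 0, 0, 0] : Fin 3 → ℝ)‖ ≤ ‖gnoLetter ε v‖ := by
    have h2 : ‖gnoLetter ε (![v 0, 0, 0] : Fin 3 → ℝ)‖ ^ 2 ≤ ‖gnoLetter ε v‖ ^ 2 := by
      rw [nQ, nP]; nlinarith [sq_nonneg (v 1), sq_nonneg (v 2)]
    calc ‖gnoLetter ε (![v 0, 0, 0] : Fin 3 → ℝ)‖ = Real.sqrt (‖gnoLetter ε (![v 0, 0, 0] : Fin 3 → ℝ)‖ ^ 2) := (Real.sqrt_sq (norm_nonneg _)).symm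
      _ ≤ Real.sqrt (‖gnoLetter ε v‖ ^ 2) := Real.sqrt_le_sqrt h2
      _ = ‖gnoLetter ε v‖ := Real.sqrt_sq (norm_nonneg _)
  have h := norm_radialUnit_sub_sq_le_of_inner_eq hp hq hinner hle
  rw [nP, nQ] at h
  refine h.trans (le_of_eq ?_)
  congr 1
  ring

/-- ★ The `z`-letter against the identity letter: `‖ν(±(1,z)) − ν(±(1,0))‖² ≤ 2|z|²/(1+|z|²)`. [folklore] -/
theorem norm_radialUnit_gnoLetter_sub_zero_sq_le (ε : Bool) (z : Fin 3 → ℝ) :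
    ‖radialUnit (gnoLetter ε z) - radialUnit (gnoLetter ε (0 : Fin 3 → ℝ))‖ ^ 2 ≤
      2 * ((z 0) ^ 2 + (z 1) ^ 2 + (z 2) ^ 2) / (1 + ((z 0) ^ 2 + (z 1) ^ 2 + (z 2) ^ 2)) := by
  have hp := gnoLetter_ne_zero ε z
  have hq := gnoLetter_ne_zero ε (0 : Fin 3 → ℝ)
  have hs : gnoSign ε ^ 2 = 1 := gnoSign_sq ε
  obtain ⟨p0, p1, p2, p3⟩ := bfar_gnoLetter_components ε z
  obtain ⟨q0, q1, q2, q3⟩ := bfar_gnoLetter_components ε (0 : Fin 3 → ℝ)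
  have nP := bfar_norm_gnoLetter_sq ε z
  have nQ := bfar_norm_gnoLetter_sq ε (0 : Fin 3 → ℝ)
  simp only [Pi.zero_apply] at q1 q2 q3 nQ
  have hinner : ⟪gnoLetter ε z, gnoLetter ε (0 : Fin 3 → ℝ)⟫ = ‖gnoLetter ε (0 : Fin 3 → ℝ)‖ ^ 2 := by
    rw [inner_eq_components, p0, p1, p2, p3, q0, q1, q2, q3, nQ]
    nlinarith [hs]
  have hle : ‖gnoLetter ε (0 : Fin 3 → ℝ)‖ ≤ ‖gnoLetter ε z‖ := by
    have h2 : ‖gnoLetter ε (0 : Fin 3 → ℝ)‖ ^ 2 ≤ ‖gnoLetter ε z‖ ^ 2 := by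
      rw [nQ, nP]; nlinarith [sq_nonneg (z 0), sq_nonneg (z 1), sq_nonneg (z 2)]
    calc ‖gnoLetter ε (0 : Fin 3 → ℝ)‖ = Real.sqrt (‖gnoLetter ε (0 : Fin 3 → ℝ)‖ ^ 2) := (Real.sqrt_sq (norm_nonneg _)).symm
      _ ≤ Real.sqrt (‖gnoLetter ε z‖ ^ 2) := Real.sqrt_le_sqrt h2
      _ = ‖gnoLetter ε z‖ := Real.sqrt_sq (norm_nonneg _)
  have h := norm_radialUnit_sub_sq_le_of_inner_eq hp hq hinner hle
  rw [nP, nQ] at h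
  refine h.trans (le_of_eq ?_)
  congr 1
  ring

/-! ## §2 The leader tuple -/

/-- Unit quaternions multiply isometrically: `‖pXrZ − pX′rZ′‖ ≤ ‖X − X′‖ + ‖Z − Z′‖` for `‖p‖ = ‖r‖ = 1`, `‖X′‖ = 1`, `‖Z‖ = 1`. [folklore] -/
theorem norm_conj_mul_sub_le {p r X X' Z Z' : ℍ} (hp : ‖p‖ = 1) (hr : ‖r‖ = 1) (hX' : ‖X'‖ = 1) (hZ : ‖Z‖ = 1) :
    ‖p * X * r * Z - p * X' * r * Z'‖ ≤ ‖X - X'‖ + ‖Z - Z'‖ := by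
  have e : p * X * r * Z - p * X' * r * Z' = p * (X - X') * r * Z + p * X' * r * (Z - Z') := by noncomm_ring
  rw [e]
  refine (norm_add_le _ _).trans ?_
  rw [norm_mul, norm_mul, norm_mul, norm_mul, norm_mul, norm_mul, hp, hr, hX', hZ]
  simp

/-- ★★ **THE LEADER GROUP DISTANCE TO THE BASE POINT** at the hub `hubAt δ 1`: for every `μ : Fin 4`,
`‖su2Quat C_μ(((x₀,0,0),(y₀,0,0)),(0,F′)) − su2Quat C_μ(((x,y),(z,F)))‖ ≤ d_x + d_z + d_y` with `d_x = √(2(x₁²+x₂²)/(1+|x|²))`, `d_y` likewise,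
`d_z = √(2|z|²/(1+|z|²))` — the `hD` input of w2's ✓`abs_log_det_gnoFolHessian_sub_le_leaders` between a slab point and its A-base point (memo11a). [folklore] -/
theorem leaderGroupDist_le (δ : ℝ) (ε : GnoSign L) (x y z : Fin 3 → ℝ) (F F' : Fol L → Fin 3 → ℝ) (μ : Fin 4) :
    ‖su2Quat ((blowUpPoint (L := L) 1 (gnomonicPoint (hubAt δ 1) ε ((((![x 0, 0, 0] : Fin 3 → ℝ), (![y 0, 0, 0] : Fin 3 → ℝ)), ((0 : Fin 3 → ℝ), F')) : GnoCoord L))).1 μ) -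
        su2Quat ((blowUpPoint (L := L) 1 (gnomonicPoint (hubAt δ 1) ε (((x, y), (z, F)) : GnoCoord L))).1 μ)‖ ≤
      Real.sqrt (2 * ((x 1) ^ 2 + (x 2) ^ 2) / (1 + ((x 0) ^ 2 + (x 1) ^ 2 + (x 2) ^ 2))) +
        Real.sqrt (2 * ((z 0) ^ 2 + (z 1) ^ 2 + (z 2) ^ 2) / (1 + ((z 0) ^ 2 + (z 1) ^ 2 + (z 2) ^ 2))) +
        Real.sqrt (2 * ((y 1) ^ 2 + (y 2) ^ 2) / (1 + ((y 0) ^ 2 + (y 1) ^ 2 + (y 2) ^ 2))) := by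
  obtain ⟨b0, b1, b2, b3⟩ := NearFlat.leaders_hubAt_letters (L := L) δ ε ((((![x 0, 0, 0] : Fin 3 → ℝ), (![y 0, 0, 0] : Fin 3 → ℝ)), ((0 : Fin 3 → ℝ), F')) : GnoCoord L)
  obtain ⟨e0, e1, e2, e3⟩ := NearFlat.leaders_hubAt_letters (L := L) δ ε (((x, y), (z, F)) : GnoCoord L)
  -- the three elementary distances
  have dX : ‖radialUnit (gnoLetter ε.1.1 (![x 0, 0, 0] : Fin 3 → ℝ)) - radialUnit (gnoLetter ε.1.1 x)‖ ≤
      Real.sqrt (2 * ((x 1) ^ 2 + (x 2) ^ 2) / (1 + ((x 0) ^ 2 + (x 1) ^ 2 + (x 2) ^ 2))) := by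
    rw [norm_sub_rev]
    exact (Real.le_sqrt (norm_nonneg _) (by positivity)).2 (norm_radialUnit_gnoLetter_sub_axial_sq_le ε.1.1 x)
  have dY : ‖radialUnit (gnoLetter ε.1.2 (![y 0, 0, 0] : Fin 3 → ℝ)) - radialUnit (gnoLetter ε.1.2 y)‖ ≤
      Real.sqrt (2 * ((y 1) ^ 2 + (y 2) ^ 2) / (1 + ((y 0) ^ 2 + (y 1) ^ 2 + (y 2) ^ 2))) := by
    rw [norm_sub_rev]
    exact (Real.le_sqrt (norm_nonneg _) (by positivity)).2 (norm_radialUnit_gnoLetter_sub_axial_sq_le ε.1.2 y)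
  have dZ : ‖radialUnit (gnoLetter ε.2.1 (0 : Fin 3 → ℝ)) - radialUnit (gnoLetter ε.2.1 z)‖ ≤
      Real.sqrt (2 * ((z 0) ^ 2 + (z 1) ^ 2 + (z 2) ^ 2) / (1 + ((z 0) ^ 2 + (z 1) ^ 2 + (z 2) ^ 2))) := by
    rw [norm_sub_rev]
    exact (Real.le_sqrt (norm_nonneg _) (by positivity)).2 (norm_radialUnit_gnoLetter_sub_zero_sq_le ε.2.1 z)
  have s0 : 0 ≤ Real.sqrt (2 * ((x 1) ^ 2 + (x 2) ^ 2) / (1 + ((x 0) ^ 2 + (x 1) ^ 2 + (x 2) ^ 2))) := Real.sqrt_nonneg _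
  have s1 : 0 ≤ Real.sqrt (2 * ((z 0) ^ 2 + (z 1) ^ 2 + (z 2) ^ 2) / (1 + ((z 0) ^ 2 + (z 1) ^ 2 + (z 2) ^ 2))) := Real.sqrt_nonneg _
  have s2 : 0 ≤ Real.sqrt (2 * ((y 1) ^ 2 + (y 2) ^ 2) / (1 + ((y 0) ^ 2 + (y 1) ^ 2 + (y 2) ^ 2))) := Real.sqrt_nonneg _
  fin_cases μ
  · -- C₀ = X̂
    simp only [Fin.zero_eta] at *
    rw [b0, e0]
    linarith [dX]
  · -- C₁ = ν(a)⁻¹ X̂ ν(a) Ẑ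
    simp only [Fin.mk_one] at *
    rw [b1, e1]
    have ha : hubAt δ 1 ≠ 0 := hubAt_one_ne_zero δ
    have hna : ‖radialUnit (hubAt δ 1)‖ = 1 := norm_radialUnit ha
    have hsa : ‖star (radialUnit (hubAt δ 1))‖ = 1 := by rw [Quaternion.norm_star, hna]
    have hX : ‖radialUnit (gnoLetter ε.1.1 x)‖ = 1 := norm_radialUnit (gnoLetter_ne_zero _ _)
    have hZ0 : ‖radialUnit (gnoLetter ε.2.1 (0 : Fin 3 → ℝ))‖ = 1 := norm_radialUnit (gnoLetter_ne_zero _ _)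
    have h := norm_conj_mul_sub_le (X := radialUnit (gnoLetter ε.1.1 (![x 0, 0, 0] : Fin 3 → ℝ))) (X' := radialUnit (gnoLetter ε.1.1 x))
      (Z := radialUnit (gnoLetter ε.2.1 (0 : Fin 3 → ℝ))) (Z' := radialUnit (gnoLetter ε.2.1 z)) hsa hna hX hZ0
    linarith [dX, dZ]
  · -- C₂ = Ŷ
    simp only [Fin.reduceFinMk] at *
    rw [b2, e2]
    linarith [dY]
  · -- C₃ = hub
    simp only [Fin.reduceFinMk] at *
    rw [b3, e3, sub_self, norm_zero]
    positivity

end Summit.QuantumFields.YangMills.Theorems.SwapVirialDeficit.BlowUpRing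

end
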